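import Summits.CriticalPhenomena.PercolationContinuityZ3.Theses.PercFoamCut
import Summits.CriticalPhenomena.PercolationContinuityZ3.Theorems.PercNearOneGluingNoHeavyLowerTailCSHTheoremOne
import Literature.Probability.Percolation.SupercriticalIsoperimetricProfileDischarge
import Literature.Probability.Percolation.AnchoredIsoperimetricProfileLowerBound
import Literature.Probability.Percolation.FiniteClusterTailZ2
import Mathlib.Analysis.SpecialFunctions.Pow.Asymptotics
import HarnessLib

/-!
# `PercFoamCut.MacroCutQuadratic` (stmt-CriticalPhenomena-5335) — PROVED

Item `stmt-CriticalPhenomena-5335` of route `CriticalPhenomena/PercFoamCut` (aside r6, "the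
rate-free closing: as MacroCutLog with budget `c n²`"): for every `p` with `θ(p) > 0` and every
`a > 0` there is `c > 0` such that
`P_p(∃ A ⊆ 𝒞_∞ ∩ Λ_n, |A| ≥ a(2n+1)³, |(𝒞_∞ ∩ Λ_n) ∖ A| ≥ a(2n+1)³, |∂_ω A| ≤ c n²) → 0`,
where `∂_ω A` is the set of OPEN lattice edges with exactly one endpoint in `A`.

Proof. `θ(p) > 0` forces `p > p_c(ℤ³)` (`θ(p_c) = 0`, `CSH.percolationContinuityZ3_holds`, p205010).
For `p > p_c`, Pete's in-box isoperimetry in RATE FORM (`Pete.exists_real_isoperimetryFails_le`, the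
discharge of Pete 2008 Cor. 1.3 [Pete2008]): outside an event of probability `≤ K n⁻²` every
open-connected `S ⊆ Λ_n` with `|S| ≥ c₃ (log n)^{3/2}` has `|∂_ω S| ≥ α |S|^{2/3}`. Decompose `A`
into open-connected components `J`: their open boundaries are disjoint subsets of `∂_ω A`, each has
`|∂_ω J| ≥ 1` (finite piece of an infinite cluster) and, if `|J| ≥ c₃ (log n)^{3/2}`,
`|∂_ω J| ≥ α|J|^{2/3} ≥ α|J|/(2n+1)`; once `α c₃ (log n)^{3/2} ≤ 2n+1` this gives
`|∂_ω A| ≥ α|A|/(2n+1) ≥ αa(2n+1)² > αa·n²`, so with `c = αa` the event has probability `≤ K n⁻²`.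
The balance hypothesis on `(𝒞_∞ ∩ Λ_n) ∖ A` is not needed.

builds on p205010 (kernel theorem, internal audit signed; external expert review pending) — USED
(`CSH.percolationContinuityZ3_holds`, only to exclude `p = p_c`). RSW3 lane, lead gen 33
(prover-prim-rsw3-lead-g33-0).
References: G. Pete, Electron. Commun. Probab. 13 (2008), Thm. 1.2 / Cor. 1.3 [Pete2008];
G. Kozma, N. Nitzan (2024) [KozmaNitzan2024].
-/

noncomputable section

namespace Summit.CriticalPhenomena.PercolationContinuityZ3.Theorems

namespace PercFoamCutMacroCutQuadratic

open MeasureTheory Literature.Probability.Percolation Literature.Probability.LatticeModels Finset Filter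
open scoped Topology

/-! ## Open-connected components of a finite set -/

section Components

variable {d : ℕ}

/-- The open component of `x` inside `A`: the points of `A` joined to `x` by an open path inside `A`
contains `x`. [folklore] -/
private theorem mem_comp_self {ω : BondConfig (Site d)} {A : Finset (Site d)} {x : Site d}
    [DecidablePred fun w => ω ∈ openConnIn (↑A : Set (Site d)) x w] (hx : x ∈ A) :
    x ∈ A.filter fun w => ω ∈ openConnIn (↑A : Set (Site d)) x w :=
  mem_filter.2 ⟨hx, openConnIn_refl (mem_coe.2 hx)⟩

/-- Open components inside `A` that meet coincide. [folklore] -/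
private theorem comp_eq_of_mem {ω : BondConfig (Site d)} {A : Finset (Site d)} {x y : Site d}
    [∀ z : Site d, DecidablePred fun w => ω ∈ openConnIn (↑A : Set (Site d)) z w]
    (hy : y ∈ A.filter fun w => ω ∈ openConnIn (↑A : Set (Site d)) x w) :
    (A.filter fun w => ω ∈ openConnIn (↑A : Set (Site d)) y w) =
      A.filter fun w => ω ∈ openConnIn (↑A : Set (Site d)) x w := by
  have hxy := (mem_filter.1 hy).2
  ext w
  simp only [mem_filter]
  constructor
  · rintro ⟨hw, h⟩
    exact ⟨hw, PlanarDuality.openConnIn_trans hxy h⟩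
  · rintro ⟨hw, h⟩
    refine ⟨hw, PlanarDuality.openConnIn_trans ?_ h⟩
    rw [openConnIn_comm]; exact hxy

/-- An open component inside `A` is open-connected INSIDE ITSELF (for lattice configurations):
the open path inside `A` joining two of its points stays in the component. [folklore] -/
private theorem openConnIn_comp {ω : BondConfig (Site d)} (hω : ω ⊆ (zdGraph d).edgeSet)
    {A : Finset (Site d)} {x y z : Site d}
    [DecidablePred fun w => ω ∈ openConnIn (↑A : Set (Site d)) x w]
    (hy : y ∈ A.filter fun w => ω ∈ openConnIn (↑A : Set (Site d)) x w)
    (hz : z ∈ A.filter fun w => ω ∈ openConnIn (↑A : Set (Site d)) x w) :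
    ω ∈ openConnIn (↑(A.filter fun w => ω ∈ openConnIn (↑A : Set (Site d)) x w) : Set (Site d)) y z := by
  classical
  have hxy := (mem_filter.1 hy).2
  have hxz := (mem_filter.1 hz).2
  have hyz : ω ∈ openConnIn (↑A : Set (Site d)) y z :=
    PlanarDuality.openConnIn_trans (by rw [openConnIn_comm]; exact hxy) hxz
  obtain ⟨W, hWA, hWω⟩ := exists_walk_of_mem_openConnIn hω hyz
  refine mem_openConnIn_of_walk W (fun v hv => ?_) hWω
  refine mem_coe.2 (mem_filter.2 ⟨mem_coe.1 (hWA v hv), ?_⟩)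
  have hyv : ω ∈ openConnIn (↑A : Set (Site d)) y v :=
    mem_openConnIn_of_walk (W.takeUntil v hv) (fun u hu => hWA u (W.support_takeUntil_subset_support hv hu))
      (fun e he => hWω e (W.edges_takeUntil_subset_edges hv he))
  exact PlanarDuality.openConnIn_trans hxy hyv

/-- An open lattice edge leaving an open component inside `A` leaves `A`. [folklore] -/
private theorem not_mem_of_boundary_comp {ω : BondConfig (Site d)} {A : Finset (Site d)} {x u v : Site d}
    [DecidablePred fun w => ω ∈ openConnIn (↑A : Set (Site d)) x w]
    (hu : u ∈ A.filter fun w => ω ∈ openConnIn (↑A : Set (Site d)) x w)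
    (hv : v ∉ A.filter fun w => ω ∈ openConnIn (↑A : Set (Site d)) x w)
    (he : s(u, v) ∈ ω) (hne : u ≠ v) : v ∉ A := by
  intro hvA
  obtain ⟨huA, hxu⟩ := mem_filter.1 hu
  exact hv (mem_filter.2 ⟨hvA, PlanarDuality.openConnIn_trans hxu
    (openConnIn_of_adj (mem_coe.2 huA) (mem_coe.2 hvA) he hne)⟩)

/-- The open boundary of an open component inside `A` is part of the open boundary of `A`.
[folklore] -/
private theorem boundary_comp_subset {ω : BondConfig (Site d)} {A : Finset (Site d)} {x : Site d}
    [DecidablePred fun w => ω ∈ openConnIn (↑A : Set (Site d)) x w] [DecidablePred fun e : Sym2 (Site d) => e ∈ ω] :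
    (edgeBoundary (zdGraph d) (A.filter fun w => ω ∈ openConnIn (↑A : Set (Site d)) x w)).filter (fun e => e ∈ ω) ⊆
      (edgeBoundary (zdGraph d) A).filter (fun e => e ∈ ω) := by
  intro e he
  obtain ⟨heB, heω⟩ := mem_filter.1 he
  rw [mem_edgeBoundary_iff] at heB
  obtain ⟨heE, ⟨u, hu, hue⟩, ⟨v, hv, hve⟩⟩ := heB
  have hne : u ≠ v := fun h => hv (h ▸ hu)
  have heuv : e = s(u, v) := by
    obtain ⟨a, b⟩ := e
    rw [Sym2.mem_iff] at hue hve
    rcases hue with rfl | rfl <;> rcases hve with h | h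
    · exact absurd h.symm hne
    · rw [h]
    · rw [h, Sym2.eq_swap]
    · exact absurd h.symm hne
  have hvA : v ∉ A := not_mem_of_boundary_comp hu hv (heuv ▸ heω) hne
  refine mem_filter.2 ⟨?_, heω⟩
  rw [mem_edgeBoundary_iff]
  exact ⟨heE, ⟨u, (mem_filter.1 hu).1, hue⟩, ⟨v, hvA, hve⟩⟩

/-- The open boundaries of two distinct open components inside `A` are disjoint. [folklore] -/
private theorem disjoint_boundary_comp {ω : BondConfig (Site d)} {A : Finset (Site d)} {x x' : Site d}
    [∀ z : Site d, DecidablePred fun w => ω ∈ openConnIn (↑A : Set (Site d)) z w]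
    [DecidablePred fun e : Sym2 (Site d) => e ∈ ω]
    (hne : (A.filter fun w => ω ∈ openConnIn (↑A : Set (Site d)) x w) ≠
      A.filter fun w => ω ∈ openConnIn (↑A : Set (Site d)) x' w) :
    Disjoint ((edgeBoundary (zdGraph d) (A.filter fun w => ω ∈ openConnIn (↑A : Set (Site d)) x w)).filter (fun e => e ∈ ω))
      ((edgeBoundary (zdGraph d) (A.filter fun w => ω ∈ openConnIn (↑A : Set (Site d)) x' w)).filter (fun e => e ∈ ω)) := by
  rw [Finset.disjoint_left]
  intro e he he'
  obtain ⟨heB, heω⟩ := mem_filter.1 he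
  obtain ⟨heB', -⟩ := mem_filter.1 he'
  rw [mem_edgeBoundary_iff] at heB heB'
  obtain ⟨-, ⟨u, hu, hue⟩, ⟨v, hv, hve⟩⟩ := heB
  obtain ⟨-, ⟨u', hu', hu'e⟩, -⟩ := heB'
  have hne' : u ≠ v := fun h => hv (h ▸ hu)
  have heuv : e = s(u, v) := by
    obtain ⟨a, b⟩ := e
    rw [Sym2.mem_iff] at hue hve
    rcases hue with rfl | rfl <;> rcases hve with h | h
    · exact absurd h.symm hne'
    · rw [h]
    · rw [h, Sym2.eq_swap]
    · exact absurd h.symm hne'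
  have hvA : v ∉ A := not_mem_of_boundary_comp hu hv (heuv ▸ heω) hne'
  rw [heuv, Sym2.mem_iff] at hu'e
  rcases hu'e with rfl | rfl
  · -- `u` lies in both components: they coincide
    exact hne ((comp_eq_of_mem hu).symm.trans (comp_eq_of_mem hu'))
  · exact hvA (mem_filter.1 hu').1

/-- **A finite piece of an infinite cluster has an open exit**: if `ω ⊆ E(ℤ^d)`, `J` is finite,
`u ∈ J` and `C(u)` is infinite, some open lattice edge has exactly one endpoint in `J`. [folklore] -/
private theorem one_le_card_boundary_of_percolates {ω : BondConfig (Site d)} (hω : ω ⊆ (zdGraph d).edgeSet)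
    {J : Finset (Site d)} {u : Site d} (hu : u ∈ J) (hinf : ω ∈ percolatesAt u)
    [DecidablePred fun e : Sym2 (Site d) => e ∈ ω] :
    1 ≤ ((edgeBoundary (zdGraph d) J).filter (fun e => e ∈ ω)).card := by
  classical
  have hinf' : (openCluster ω u).Infinite := hinf
  obtain ⟨y, hy, hyJ⟩ : ∃ y ∈ openCluster ω u, y ∉ J := by
    by_contra h
    push Not at h
    exact hinf' (J.finite_toSet.subset fun y hy => mem_coe.2 (h y hy))
  obtain ⟨W₀⟩ : (openGraph ω).Reachable u y := hy
  have hle : openGraph ω ≤ zdGraph d := fun a b hab => by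
    have h1 := ((openGraph_adj ω a b).1 hab).1
    exact hω h1
  set W := W₀.mapLe hle with hW
  have hWω : ∀ e ∈ W.edges, e ∈ ω := by
    intro e he
    rw [hW, SimpleGraph.Walk.edges_mapLe_eq_edges] at he
    exact edgeSet_openGraph_subset ω (W₀.edges_subset_edgeSet he)
  obtain ⟨f, g, hf, hg, hadj, hfg, -, -⟩ := exists_prefix_exit_edge (↑J : Set (Site d)) W (mem_coe.2 hu)
    (fun h => hyJ (mem_coe.1 h))
  refine card_pos.2 ⟨s(f, g), mem_filter.2 ⟨?_, hWω _ hfg⟩⟩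
  rw [mem_edgeBoundary_iff]
  exact ⟨(zdGraph d).mem_edgeSet.2 hadj, ⟨f, mem_coe.1 hf, Sym2.mem_mk_left _ _⟩,
    ⟨g, fun h => hg (mem_coe.2 h), Sym2.mem_mk_right _ _⟩⟩

end Components

/-! ## The deterministic core -/

/-- `s^{2/3} ≥ s/(2n+1)` for `0 ≤ s ≤ (2n+1)³`. [folklore] -/
private theorem rpow_two_thirds_ge {s : ℝ} {n : ℕ} (hs : 0 ≤ s) (hsn : s ≤ (2 * (n : ℝ) + 1) ^ 3) :
    s / (2 * (n : ℝ) + 1) ≤ s ^ (1 - 1 / (3 : ℝ)) := by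
  have hN : (0 : ℝ) < 2 * (n : ℝ) + 1 := by positivity
  rw [div_le_iff₀ hN]
  have h13 : s ^ (1 / (3 : ℝ)) ≤ 2 * (n : ℝ) + 1 := by
    calc s ^ (1 / (3 : ℝ)) ≤ ((2 * (n : ℝ) + 1) ^ 3) ^ (1 / (3 : ℝ)) :=
          Real.rpow_le_rpow hs hsn (by norm_num)
      _ = 2 * (n : ℝ) + 1 := by
          rw [one_div, show ((2 * (n : ℝ) + 1) ^ 3) = (2 * (n : ℝ) + 1) ^ (3 : ℕ) by norm_cast]
          exact Real.pow_rpow_inv_natCast hN.le (by norm_num)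
  calc s = s ^ (1 - 1 / (3 : ℝ)) * s ^ (1 / (3 : ℝ)) := by
        rw [← Real.rpow_add' hs (by norm_num)]; norm_num
    _ ≤ s ^ (1 - 1 / (3 : ℝ)) * (2 * (n : ℝ) + 1) :=
        mul_le_mul_of_nonneg_left h13 (Real.rpow_nonneg hs _)

/-- **Deterministic core.** Let `ω ⊆ E(ℤ³)`, `A ⊆ Λ_n` a set of percolating sites, and assume
Pete's isoperimetry at level `n` (every open-connected `S ⊆ Λ_n` with `|S| ≥ c₃ L` has
`|∂_ω S| ≥ α |S|^{2/3}`, `L = (log n)^{3/2}`) together with `α c₃ L ≤ 2n+1`. Then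
`α |A| ≤ (2n+1) |∂_ω A|` (decomposition of `A` into open components; each has
`|∂_ω J| ≥ α|J|/(2n+1)`). [cite: Pete2008, Cor. 1.3 (consequence)] -/
theorem mul_card_le_of_isoperimetry {ω : BondConfig (Site 3)} (hω : ω ⊆ (zdGraph 3).edgeSet) {n : ℕ}
    {c₃ α : ℝ} (hα : 0 < α)
    (hgood : ∀ S : Finset (Site 3), S ⊆ box 3 n →
      (∀ x ∈ S, ∀ y ∈ S, ω ∈ openConnIn (↑S : Set (Site 3)) x y) →
      c₃ * Real.log (n : ℝ) ^ ((3 : ℝ) / ((3 : ℝ) - 1)) ≤ (S.card : ℝ) →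
      α * (S.card : ℝ) ^ (1 - 1 / (3 : ℝ)) ≤ (openEdgeBoundaryCard 3 ω S : ℝ))
    (hn : α * (c₃ * Real.log (n : ℝ) ^ ((3 : ℝ) / ((3 : ℝ) - 1))) ≤ 2 * (n : ℝ) + 1)
    (A : Finset (Site 3)) (hA : ∀ x ∈ A, x ∈ box 3 n ∧ ω ∈ percolatesAt x)
    [DecidablePred fun e : Sym2 (Site 3) => e ∈ ω] :
    α * (A.card : ℝ) ≤ (2 * (n : ℝ) + 1) * (((edgeBoundary (zdGraph 3) A).filter (fun e => e ∈ ω)).card : ℝ) := by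
  classical
  have hN : (0 : ℝ) < 2 * (n : ℝ) + 1 := by positivity
  set comp : Site 3 → Finset (Site 3) := fun x => A.filter fun w => ω ∈ openConnIn (↑A : Set (Site 3)) x w
    with hcomp
  set comps : Finset (Finset (Site 3)) := A.image comp with hcomps
  set T : Finset (Site 3) → Finset (Sym2 (Site 3)) := fun J => (edgeBoundary (zdGraph 3) J).filter fun e => e ∈ ω
    with hT
  -- every component: `α |J| ≤ (2n+1) |T J|`
  have hJ : ∀ J ∈ comps, α * (J.card : ℝ) ≤ (2 * (n : ℝ) + 1) * ((T J).card : ℝ) := by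
    intro J hJ
    obtain ⟨x, hxA, rfl⟩ := mem_image.1 hJ
    have hsubA : comp x ⊆ A := filter_subset _ _
    have hsub : comp x ⊆ box 3 n := fun y hy => (hA y (hsubA hy)).1
    have hconn : ∀ y ∈ comp x, ∀ z ∈ comp x, ω ∈ openConnIn (↑(comp x) : Set (Site 3)) y z :=
      fun y hy z hz => openConnIn_comp hω hy hz
    have hone : (1 : ℝ) ≤ ((T (comp x)).card : ℝ) := by
      have h := one_le_card_boundary_of_percolates hω (mem_comp_self hxA) (hA x hxA).2 (J := comp x)
      exact_mod_cast h
    by_cases hbig : c₃ * Real.log (n : ℝ) ^ ((3 : ℝ) / ((3 : ℝ) - 1)) ≤ ((comp x).card : ℝ)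
    · -- Pete's isoperimetry
      have h1 := hgood (comp x) hsub hconn hbig
      have hTeq : (openEdgeBoundaryCard 3 ω (comp x) : ℝ) = ((T (comp x)).card : ℝ) := by
        have hset : ((T (comp x) : Finset (Sym2 (Site 3))) : Set (Sym2 (Site 3))) =
            ((edgeBoundary (zdGraph 3) (comp x) : Finset (Sym2 (Site 3))) : Set (Sym2 (Site 3))) ∩ ω := by
          ext e; simp [hT]
        unfold openEdgeBoundaryCard
        rw [← hset, Set.ncard_coe_finset]
      have hcardle : ((comp x).card : ℝ) ≤ (2 * (n : ℝ) + 1) ^ 3 := by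
        have h := (card_le_card hsub).trans (card_box 3 n).le
        exact_mod_cast h
      calc α * ((comp x).card : ℝ) = (2 * (n : ℝ) + 1) * (α * (((comp x).card : ℝ) / (2 * (n : ℝ) + 1))) := by
            field_simp
        _ ≤ (2 * (n : ℝ) + 1) * (α * ((comp x).card : ℝ) ^ (1 - 1 / (3 : ℝ))) := by
            gcongr
            exact rpow_two_thirds_ge (Nat.cast_nonneg _) hcardle
        _ ≤ (2 * (n : ℝ) + 1) * ((T (comp x)).card : ℝ) := by
            rw [← hTeq]; exact mul_le_mul_of_nonneg_left h1 hN.le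
    · -- small component: `α |J| ≤ α c₃ L ≤ 2n+1 ≤ (2n+1) |T J|`
      push Not at hbig
      calc α * ((comp x).card : ℝ) ≤ α * (c₃ * Real.log (n : ℝ) ^ ((3 : ℝ) / ((3 : ℝ) - 1))) :=
            mul_le_mul_of_nonneg_left hbig.le hα.le
        _ ≤ (2 * (n : ℝ) + 1) * 1 := by rw [mul_one]; exact hn
        _ ≤ (2 * (n : ℝ) + 1) * ((T (comp x)).card : ℝ) := mul_le_mul_of_nonneg_left hone hN.le
  have hAcard : (A.card : ℝ) ≤ ∑ J ∈ comps, (J.card : ℝ) := by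
    have h1 : A ⊆ comps.biUnion id := fun x hx =>
      mem_biUnion.2 ⟨comp x, mem_image_of_mem _ hx, mem_comp_self hx⟩
    have h2 : A.card ≤ ∑ J ∈ comps, J.card := (card_le_card h1).trans card_biUnion_le
    exact_mod_cast h2
  have hTcard : ∑ J ∈ comps, ((T J).card : ℝ) ≤ ((T A).card : ℝ) := by
    have hdisj : ((comps : Finset (Finset (Site 3))) : Set (Finset (Site 3))).PairwiseDisjoint T := by
      intro J hJ J' hJ' hne
      obtain ⟨x, -, rfl⟩ := mem_image.1 (mem_coe.1 hJ)
      obtain ⟨x', -, rfl⟩ := mem_image.1 (mem_coe.1 hJ')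
      exact disjoint_boundary_comp hne
    have hsub : comps.biUnion T ⊆ T A := by
      intro e he
      obtain ⟨J, hJ, heJ⟩ := mem_biUnion.1 he
      obtain ⟨x, -, rfl⟩ := mem_image.1 hJ
      exact boundary_comp_subset heJ
    have h := (card_biUnion hdisj).symm.le.trans (card_le_card hsub)
    exact_mod_cast h
  calc α * (A.card : ℝ) ≤ α * ∑ J ∈ comps, (J.card : ℝ) := mul_le_mul_of_nonneg_left hAcard hα.le
    _ = ∑ J ∈ comps, α * (J.card : ℝ) := by rw [mul_sum]
    _ ≤ ∑ J ∈ comps, (2 * (n : ℝ) + 1) * ((T J).card : ℝ) := sum_le_sum hJ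
    _ = (2 * (n : ℝ) + 1) * ∑ J ∈ comps, ((T J).card : ℝ) := by rw [mul_sum]
    _ ≤ (2 * (n : ℝ) + 1) * ((T A).card : ℝ) := mul_le_mul_of_nonneg_left hTcard hN.le

/-! ## The item -/

/-- **`PercFoamCut.MacroCutQuadratic` (stmt-CriticalPhenomena-5335), proved**: for `θ(p) > 0` and
`a > 0` there is `c > 0` (`c = α a`, `α` = Pete's isoperimetric constant at `p`) with
`P_p(∃ A ⊆ 𝒞_∞ ∩ Λ_n` balanced, `|∂_ω A| ≤ c n²) → 0`; indeed the probability is `O(n⁻²)`.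
From Pete 2008 Cor. 1.3 in rate form (discharged this generation) by decomposing `A` into open
components, and `p > p_c` from `θ(p_c) = 0`.
[cite: Pete2008, Cor. 1.3] [cite: KozmaNitzan2024, Thm. 6 with Conj. 3 (p. 15)] -/
theorem macroCutQuadratic_proof :
    Summit.CriticalPhenomena.PercolationContinuityZ3.Theses.PercFoamCut.MacroCutQuadratic := by
  unfold Summit.CriticalPhenomena.PercolationContinuityZ3.Theses.PercFoamCut.MacroCutQuadratic
  intro p hθ a ha
  classical
  -- `θ(p) > 0` forces `p > p_c(ℤ³)`: below `p_c` by definition, at `p_c` by `θ(p_c) = 0` (p205010)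
  have hpc : criticalProb (zdGraph 3) (0 : Site 3) < (p : ℝ) := by
    rcases lt_or_ge (criticalProb (zdGraph 3) (0 : Site 3)) (p : ℝ) with h | h
    · exact h
    exfalso
    rcases h.lt_or_eq with hlt | heq
    · exact hθ.ne' (theta_eq_zero_of_lt_criticalProb_holds (zdGraph 3) (0 : Site 3) p hlt)
    · have hp : p = criticalProbI 3 := Subtype.ext heq
      rw [hp] at hθ
      exact hθ.ne' CSH.percolationContinuityZ3_holds
  obtain ⟨c₃, α, K, hc₃, hα, N₁, hrate⟩ := Pete.exists_real_isoperimetryFails_le (d := 3) (by norm_num) p hpc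
  set μ := bondPercolation (zdGraph 3) p with hμ
  refine ⟨α * a, mul_pos hα ha, ?_⟩
  -- eventually `α c₃ (log n)^{3/2} ≤ 2n+1`
  have hev : ∀ᶠ n : ℕ in atTop, α * (c₃ * Real.log (n : ℝ) ^ ((3 : ℝ) / ((3 : ℝ) - 1))) ≤ 2 * (n : ℝ) + 1 := by
    have h := eventually_mul_log_rpow_le (d := 1) one_ne_zero (α * c₃) ((3 : ℝ) / ((3 : ℝ) - 1))
    filter_upwards [h] with n hn
    have h1 : ((n ^ 1 : ℕ) : ℝ) = (n : ℝ) := by simp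
    rw [h1] at hn
    linarith
  obtain ⟨N₂, hN₂⟩ := eventually_atTop.1 hev
  -- the bound `μ(E_n) ≤ K n⁻²` for `n ≥ max N₁ N₂`
  set G : Set (BondConfig (Site 3)) := {ω | ω ⊆ (zdGraph 3).edgeSet} with hG
  have hGc : μ.real Gᶜ = 0 := by
    have h : μ Gᶜ = 0 := by
      have := ae_subset_edgeSet (zdGraph 3) p
      rw [Filter.Eventually, mem_ae_iff] at this
      exact this
    simp [Measure.real, h]
  have hbound : ∀ n : ℕ, max N₁ N₂ ≤ n →
      μ.real {ω | ∃ A : Finset (Site 3), (∀ x ∈ A, x ∈ box 3 n ∧ ω ∈ percolatesAt x) ∧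
        a * (2 * (n : ℝ) + 1) ^ 3 ≤ (A.card : ℝ) ∧
        a * (2 * (n : ℝ) + 1) ^ 3 ≤ (((box 3 n).filter (fun x => ω ∈ percolatesAt x ∧ x ∉ A)).card : ℝ) ∧
        (((edgeBoundary (zdGraph 3) A).filter (fun e => e ∈ ω)).card : ℝ) ≤ α * a * (n : ℝ) ^ 2} ≤
      K * ((n : ℝ)⁻¹) ^ 2 := by
    intro n hn
    have hnN₁ : N₁ ≤ n := le_of_max_le_left hn
    have hnN₂ : N₂ ≤ n := le_of_max_le_right hn
    set E : Set (BondConfig (Site 3)) := {ω | ∃ A : Finset (Site 3), (∀ x ∈ A, x ∈ box 3 n ∧ ω ∈ percolatesAt x) ∧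
        a * (2 * (n : ℝ) + 1) ^ 3 ≤ (A.card : ℝ) ∧
        a * (2 * (n : ℝ) + 1) ^ 3 ≤ (((box 3 n).filter (fun x => ω ∈ percolatesAt x ∧ x ∉ A)).card : ℝ) ∧
        (((edgeBoundary (zdGraph 3) A).filter (fun e => e ∈ ω)).card : ℝ) ≤ α * a * (n : ℝ) ^ 2} with hE
    -- inclusion in Pete's failure event, up to the null set `Gᶜ`
    have hsub : E ∩ G ⊆
        {ω : BondConfig (Site 3) | ∃ S : Finset (Site 3), S ⊆ box 3 n ∧
          (∀ x ∈ S, ∀ y ∈ S, ω ∈ openConnIn (↑S : Set (Site 3)) x y) ∧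
          c₃ * Real.log (n : ℝ) ^ ((3 : ℝ) / ((3 : ℝ) - 1)) ≤ (S.card : ℝ) ∧
          (openEdgeBoundaryCard 3 ω S : ℝ) < α * (S.card : ℝ) ^ (1 - 1 / (3 : ℝ))} := by
      rintro ω ⟨hωEv, hωE⟩
      obtain ⟨A, hA, hAcard, -, hAbd⟩ := hωEv
      by_contra hgood
      simp only [Set.mem_setOf_eq, not_exists, not_and, not_lt] at hgood
      have hcore := mul_card_le_of_isoperimetry hωE hα (fun S hS hconn hsize => hgood S hS hconn hsize)
        (hN₂ n hnN₂) A hA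
      have hN : (0 : ℝ) < 2 * (n : ℝ) + 1 := by positivity
      -- `α a (2n+1)³ ≤ α|A| ≤ (2n+1)|∂A| ≤ (2n+1) α a n²`, contradiction
      have h1 : α * (a * (2 * (n : ℝ) + 1) ^ 3) ≤ (2 * (n : ℝ) + 1) * (α * a * (n : ℝ) ^ 2) :=
        calc α * (a * (2 * (n : ℝ) + 1) ^ 3) ≤ α * (A.card : ℝ) := mul_le_mul_of_nonneg_left hAcard hα.le
          _ ≤ (2 * (n : ℝ) + 1) * (((edgeBoundary (zdGraph 3) A).filter (fun e => e ∈ ω)).card : ℝ) := by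
              convert hcore using 3
          _ ≤ (2 * (n : ℝ) + 1) * (α * a * (n : ℝ) ^ 2) := mul_le_mul_of_nonneg_left hAbd hN.le
      have h2 : (2 * (n : ℝ) + 1) * (α * a * (n : ℝ) ^ 2) < α * (a * (2 * (n : ℝ) + 1) ^ 3) := by
        have hαa : 0 < α * a := mul_pos hα ha
        have h3 : (n : ℝ) ^ 2 < (2 * (n : ℝ) + 1) ^ 2 := by
          have : (0 : ℝ) ≤ n := Nat.cast_nonneg n
          nlinarith
        calc (2 * (n : ℝ) + 1) * (α * a * (n : ℝ) ^ 2) = (α * a) * ((2 * (n : ℝ) + 1) * (n : ℝ) ^ 2) := by ring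
          _ < (α * a) * ((2 * (n : ℝ) + 1) * (2 * (n : ℝ) + 1) ^ 2) := by
              exact mul_lt_mul_of_pos_left (mul_lt_mul_of_pos_left h3 hN) hαa
          _ = α * (a * (2 * (n : ℝ) + 1) ^ 3) := by ring
      exact absurd h1 (not_le.2 h2)
    calc μ.real E ≤ μ.real (E ∩ G ∪ Gᶜ) :=
          measureReal_mono (fun ω hω => by
            by_cases h : ω ∈ G
            · exact Or.inl ⟨hω, h⟩
            · exact Or.inr h) (measure_ne_top _ _)
      _ ≤ μ.real (E ∩ G) + μ.real Gᶜ := measureReal_union_le _ _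
      _ ≤ K * ((n : ℝ)⁻¹) ^ 2 + 0 := by
          rw [hGc]
          exact add_le_add ((measureReal_mono hsub (measure_ne_top _ _)).trans (hrate n hnN₁)) le_rfl
      _ = K * ((n : ℝ)⁻¹) ^ 2 := add_zero _
  have hK : Tendsto (fun n : ℕ => K * ((n : ℝ)⁻¹) ^ 2) atTop (𝓝 0) := by
    have h1 : Tendsto (fun n : ℕ => ((n : ℝ)⁻¹) ^ 2) atTop (𝓝 0) := by
      have h := (tendsto_inv_atTop_nhds_zero_nat (𝕜 := ℝ)).pow 2
      simpa using h
    simpa using h1.const_mul K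
  refine tendsto_of_tendsto_of_tendsto_of_le_of_le' tendsto_const_nhds hK ?_ ?_
  · exact Eventually.of_forall fun n => measureReal_nonneg
  · exact (eventually_ge_atTop (max N₁ N₂)).mono fun n hn => hbound n hn

end PercFoamCutMacroCutQuadratic

end Summit.CriticalPhenomena.PercolationContinuityZ3.Theorems

end
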